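import Summits.Ventures.CertifiedArithmetic.LowPrec.EnvelopeAtoms
import Summits.Ventures.CertifiedArithmetic.LowPrec.EnvelopeAtomsRegimes
import Summits.Ventures.CertifiedArithmetic.LowPrec.GemmEnvelopeDecomposition
import Mathlib.Algebra.Order.Round

/-!
# GemmEnvelopeScaled — scaled low-precision quantisers as instances of the E-DEC operand atoms (LXX-b)

HONEST FRAMING: certified error envelopes and provably optimal rounding/accumulation schemes for
low-precision formats under stated cost models; every table by two implementations; no hardware or
vendor claims.

The E-DEC envelope of `GemmEnvelopeDecomposition` asks for per-element RELATIVE operand atoms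
`|q - v| ≤ u_Q · |v|`. This file discharges them for every scaled quantiser of the cell's configuration
table (THEOREM-SHAPES §1) — hardware-agnostically: the quantiser is described by the VALUE it denotes,
`q = X · fl_φ(v / X)` for a positive scale `X` (no claim about how a device computes or stores it).

* `scaled_rel_error_le` — the atom for ANY positive scale `X`: if `v/X` lies in the normal range of
  `φ` (`2^m · quantum ≤ |v|/X ≤ maxRat`) then `|q - v| ≤ u/(1+u) · |v|` (`EnvelopeAtoms.roundNERelSharp`
  scaled back; `u/(1+u) = 1/17, 1/9, 1/5` for E4M3, E5M2, E2M1 — `EnvelopeAtoms.sharpUnit_values`).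
* MX / shared power-of-two CEIL scale `X = SR.ceilScale φ V` of a block `V` (X2, Y2; also any
  per-tile ceil scale): no element clips, and an element with `blockMax V ≤ κ · |Vᵢ|`,
  `κ · 2 · 2^m · quantum ≤ maxRat` (E4M3: `κ ≤ 14336`) is normal after scaling — by the MINIMALITY of
  the ceil scale (`SR.ceilScale_mul_maxRat_lt_two_mul`): `mxCeil_rel_error_le`.
* Per-vector (or per-tensor) FP scaling with ANY covering scale numerator `A ≥ |v|`, `X = A / maxRat`
  (the ideal rule takes `A = ‖v‖_∞`; a stale / delayed / upward-rounded `A` that still covers the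
  vector is the same theorem — THEOREM-SHAPES D17): an element with `A ≤ κ · |v|`,
  `κ · 2^m · quantum ≤ maxRat` (E4M3: `κ ≤ 28672`) is normal: `vec_rel_error_le`.
* Symmetric INTEGER quantisation with `N` positive levels (INT8: `N = 127`), `q = (A/N) · round(v·N/A)`
  (Mathlib's `round`, ties up — the rounding-mode slot D-INT of the table; half-away agrees except on
  negative ties): `|q - v| ≤ A/(2N)`, hence `≤ κ/(2N) · |v|` when `A ≤ κ · |v|`: `intQ_rel_error_le`.

The GEMM-level envelopes then follow from `GemmEnvelope.eDec` in one step each (`gemm_mxCeil_envelope`,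
`gemm_vec_envelope`, `gemm_intQ_envelope`): for operands quantised in the same element format,
`|c - ∑ aₖbₖ| ≤ (2u' + u'² + γ(1+u')² + δ(1+γ)(1+u')²) · ∑ |aₖ bₖ|` on the classes where every element
is normal after scaling; the accumulation (`γ`) and output (`δ`) lines are hypotheses to be discharged
by `AccumulateTwoLevel` / `MXGemm` or set to `0` for exact (integer / Kulisch) accumulation.
No `sorry`; axioms `propext`, `Classical.choice`, `Quot.sound` only.
-/

namespace Summit.Ventures.CertifiedArithmetic.LowPrec.GemmEnvelope

open Finset
open Literature.ComputerArithmetic.FloatingPoint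
open Literature.ComputerArithmetic.FloatingPoint.Format
open Literature.ComputerArithmetic.FloatingPoint.MiniFloat
open Literature.ComputerArithmetic.FloatingPoint.MXBlock
open Summit.Ventures.CertifiedArithmetic.LowPrec.SR

/-! ## The scaled atom -/

/-- THE SCALED RELATIVE ATOM: for any positive scale `X`, if `v / X` is in the normal range of `φ`
then `q = X · fl(v/X)` reproduces `v` with relative error at most `u/(1+u)`.
[cite: JeannerodRump2018, eq. (1.2)] -/
theorem scaled_rel_error_le (φ : Format) {X v : ℚ} (hX : 0 < X)
    (hlo : 2 ^ φ.manBits * φ.quantum ≤ |v| / X) (hhi : |v| / X ≤ φ.maxRat) :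
    |X * (roundNE φ (v / X)).toRat - v| ≤ φ.unitRoundoff / (1 + φ.unitRoundoff) * |v| := by
  have habs : |v / X| = |v| / X := by rw [abs_div, abs_of_pos hX]
  have h := abs_sub_roundNE_le_sharp (φ := φ) (x := v / X) (by rwa [habs]) (by rwa [habs])
  have hfac : X * (roundNE φ (v / X)).toRat - v
      = -(X * (v / X - (roundNE φ (v / X)).toRat)) := by
    rw [mul_sub, mul_div_cancel₀ _ (ne_of_gt hX)]; ring
  rw [hfac, abs_neg, abs_mul, abs_of_pos hX]
  calc X * |v / X - (roundNE φ (v / X)).toRat|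
      ≤ X * (φ.unitRoundoff / (1 + φ.unitRoundoff) * |v / X|) := mul_le_mul_of_nonneg_left h hX.le
    _ = φ.unitRoundoff / (1 + φ.unitRoundoff) * |v| := by
        rw [habs, mul_left_comm, mul_div_cancel₀ _ (ne_of_gt hX)]

/-- The scaled quantiser maps `0` to `0` (any scale, even `X = 0`). [folklore] -/
theorem scaled_zero (φ : Format) (X : ℚ) : X * (roundNE φ ((0 : ℚ) / X)).toRat = 0 := by
  rw [zero_div, toRat_roundNE_zero, mul_zero]

/-! ## MX / shared power-of-two CEIL scale -/

/-- Under the ceil scale an element `Vᵢ ≠ 0` whose block has dynamic range `blockMax V ≤ κ · |Vᵢ|`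
with `κ · (2 · 2^m · quantum) ≤ maxRat` is NORMAL after scaling — because the ceil scale is minimal
(`X · maxRat < 2 · blockMax V`). [cite: RouhaniEtAl2023MX, §3] -/
theorem mxCeil_normal_of_kappa (φ : Format) {k : ℕ} (V : Fin k → ℚ) (i : Fin k)
    (hM : 0 < φ.maxRat) {κ : ℚ} (hVi : V i ≠ 0) (hκ : blockMax V ≤ κ * |V i|)
    (hκM : κ * (2 * (2 ^ φ.manBits * φ.quantum)) ≤ φ.maxRat) :
    2 ^ φ.manBits * φ.quantum ≤ |V i| / ceilScale φ V := by
  have hpos : 0 < |V i| := abs_pos.mpr hVi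
  have hB : 0 < blockMax V := lt_of_lt_of_le hpos (abs_le_blockMax V i)
  have hX := ceilScale_pos φ V
  have hlt := ceilScale_mul_maxRat_lt_two_mul hM hB
  have h0 : |V i| ≤ κ * |V i| := le_trans (abs_le_blockMax V i) hκ
  have hκpos : 0 < κ := by nlinarith
  have h1 : ceilScale φ V * (κ * (2 * (2 ^ φ.manBits * φ.quantum))) ≤ ceilScale φ V * φ.maxRat :=
    mul_le_mul_of_nonneg_left hκM hX.le
  have h2 : (2 * κ) * (ceilScale φ V * (2 ^ φ.manBits * φ.quantum)) < (2 * κ) * |V i| := by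
    nlinarith
  have h3 : ceilScale φ V * (2 ^ φ.manBits * φ.quantum) < |V i| :=
    lt_of_mul_lt_mul_left h2 (by positivity)
  rw [le_div_iff₀ hX]
  linarith

/-- No element clips under the ceil scale: `|Vᵢ| / X ≤ maxRat`. [cite: RouhaniEtAl2023MX, §3] -/
theorem mxCeil_scaled_le_maxRat (φ : Format) {k : ℕ} (V : Fin k → ℚ) (i : Fin k)
    (hM : 0 < φ.maxRat) : |V i| / ceilScale φ V ≤ φ.maxRat := by
  rw [div_le_iff₀ (ceilScale_pos φ V), mul_comm]
  exact le_trans (abs_le_blockMax V i) (blockMax_le_ceilScale_mul hM V)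

/-- MX CEIL RELATIVE ATOM on the class `C_blk(κ)`: every element of a block with
`Vᵢ = 0 ∨ blockMax V ≤ κ · |Vᵢ|`, `κ · 2 · 2^m · quantum ≤ maxRat`, is reproduced by
`X · fl(Vᵢ/X)`, `X = ceilScale φ V`, with relative error at most `u/(1+u)`.
[cite: RouhaniEtAl2023MX, §3] -/
theorem mxCeil_rel_error_le (φ : Format) {k : ℕ} (V : Fin k → ℚ) (i : Fin k) (hM : 0 < φ.maxRat)
    {κ : ℚ} (hκ : V i = 0 ∨ blockMax V ≤ κ * |V i|)
    (hκM : κ * (2 * (2 ^ φ.manBits * φ.quantum)) ≤ φ.maxRat) :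
    |ceilScale φ V * (roundNE φ (V i / ceilScale φ V)).toRat - V i|
      ≤ φ.unitRoundoff / (1 + φ.unitRoundoff) * |V i| := by
  by_cases hVi : V i = 0
  · rw [hVi, scaled_zero]; simp
  · have hκ' : blockMax V ≤ κ * |V i| := hκ.resolve_left hVi
    exact scaled_rel_error_le φ (ceilScale_pos φ V) (mxCeil_normal_of_kappa φ V i hM hVi hκ' hκM)
      (mxCeil_scaled_le_maxRat φ V i hM)

/-! ## Per-vector FP scaling with a covering scale numerator -/

/-- PER-VECTOR RELATIVE ATOM: with scale `X = A / maxRat` for ANY numerator `A` covering the element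
(`|v| ≤ A`; the ideal rule is `A = ‖v‖_∞`) and `v = 0 ∨ A ≤ κ · |v|` with `κ · 2^m · quantum ≤ maxRat`
(E4M3: `κ ≤ 28672`), `|q - v| ≤ u/(1+u) · |v|`. [cite: MicikeviciusEtAl2022, §3] -/
theorem vec_rel_error_le (φ : Format) (hM : 0 < φ.maxRat) {A v κ : ℚ} (hv : |v| ≤ A)
    (hκ : v = 0 ∨ A ≤ κ * |v|) (hκM : κ * (2 ^ φ.manBits * φ.quantum) ≤ φ.maxRat) :
    |A / φ.maxRat * (roundNE φ (v / (A / φ.maxRat))).toRat - v|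
      ≤ φ.unitRoundoff / (1 + φ.unitRoundoff) * |v| := by
  by_cases hv0 : v = 0
  · rw [hv0, scaled_zero]; simp
  · have hκ' : A ≤ κ * |v| := hκ.resolve_left hv0
    have hpos : 0 < |v| := abs_pos.mpr hv0
    have hA : 0 < A := lt_of_lt_of_le hpos hv
    have hX : 0 < A / φ.maxRat := div_pos hA hM
    have hκpos : 0 < κ := by nlinarith
    have hP : 0 ≤ (2 : ℚ) ^ φ.manBits * φ.quantum := mul_nonneg (by positivity) φ.quantum_pos.le
    refine scaled_rel_error_le φ hX ?_ ?_
    · rw [le_div_iff₀ hX]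
      have h1 : 2 ^ φ.manBits * φ.quantum * A ≤ 2 ^ φ.manBits * φ.quantum * (κ * |v|) :=
        mul_le_mul_of_nonneg_left hκ' hP
      have h2 : 2 ^ φ.manBits * φ.quantum * (κ * |v|) ≤ φ.maxRat * |v| := by nlinarith
      have h3 : 2 ^ φ.manBits * φ.quantum * (A / φ.maxRat)
          = 2 ^ φ.manBits * φ.quantum * A / φ.maxRat := by ring
      rw [h3, div_le_iff₀ hM]
      nlinarith
    · rw [div_le_iff₀ hX, mul_div_cancel₀ _ (ne_of_gt hM)]
      exact hv

/-! ## Symmetric integer quantisation -/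

/-- INTEGER QUANTISER, absolute atom: `|s · round(v/s) - v| ≤ s/2` for a positive step `s`
(Mathlib `round`: ties up). [folklore] -/
theorem intQ_abs_error_le {s : ℚ} (hs : 0 < s) (v : ℚ) :
    |s * (round (v / s) : ℚ) - v| ≤ s / 2 := by
  have h := abs_sub_round (v / s)
  have hfac : s * (round (v / s) : ℚ) - v = -(s * (v / s - (round (v / s) : ℚ))) := by
    rw [mul_sub, mul_div_cancel₀ _ (ne_of_gt hs)]; ring
  rw [hfac, abs_neg, abs_mul, abs_of_pos hs]
  calc s * |v / s - (round (v / s) : ℚ)| ≤ s * (1 / 2) := mul_le_mul_of_nonneg_left h hs.le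
    _ = s / 2 := by ring

/-- INTEGER QUANTISER, relative atom on the class `v = 0 ∨ A ≤ κ·|v|` with a covering numerator
`|v| ≤ A` and `N` positive levels (`s = A/N`; INT8: `N = 127`, atom `κ/254`):
`|q - v| ≤ κ/(2N) · |v|`. [folklore] -/
theorem intQ_rel_error_le {A N v κ : ℚ} (hN : 0 < N) (hv : |v| ≤ A) (hκ : v = 0 ∨ A ≤ κ * |v|) :
    |A / N * (round (v / (A / N)) : ℚ) - v| ≤ κ / (2 * N) * |v| := by
  by_cases hv0 : v = 0
  · rw [hv0, zero_div, round_zero, Int.cast_zero, mul_zero]; simp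
  · have hκ' : A ≤ κ * |v| := hκ.resolve_left hv0
    have hpos : 0 < |v| := abs_pos.mpr hv0
    have hA : 0 < A := lt_of_lt_of_le hpos hv
    have hs : 0 < A / N := div_pos hA hN
    calc |A / N * (round (v / (A / N)) : ℚ) - v| ≤ A / N / 2 := intQ_abs_error_le hs v
      _ ≤ κ * |v| / N / 2 := by gcongr
      _ = κ / (2 * N) * |v| := by ring

/-! ## GEMM-level envelopes -/

/-- MX GEMM ENVELOPE (functional F1) for the shared power-of-two CEIL scale on both operands, one
scale per block `j` and operand, element format `φ` for both: on the class where every nonzero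
element has `blockMax ≤ κ·|element|` with `κ · 2 · 2^m · quantum ≤ maxRat`, any accumulation with
`|acc - ∑∑ qa qb| ≤ γ ∑∑ |qa qb|` and any output step with `|c - acc| ≤ δ|acc|` give
`|c - ∑∑ a b| ≤ (ε + γ(1+ε) + δ(1+ε)(1+γ)) · ∑∑ |a b|`, `ε = 2u' + u'²`, `u' = u/(1+u)`.
[cite: RouhaniEtAl2023MX, §2] -/
theorem gemm_mxCeil_envelope (φ : Format) (hM : 0 < φ.maxRat) {B k : ℕ}
    (a b qa qb : Fin B → Fin k → ℚ) {κ γ δ acc c : ℚ} (hγ : 0 ≤ γ) (hδ : 0 ≤ δ)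
    (hκM : κ * (2 * (2 ^ φ.manBits * φ.quantum)) ≤ φ.maxRat)
    (hca : ∀ j i, a j i = 0 ∨ blockMax (a j) ≤ κ * |a j i|)
    (hcb : ∀ j i, b j i = 0 ∨ blockMax (b j) ≤ κ * |b j i|)
    (hqa : ∀ j i, qa j i = ceilScale φ (a j) * (roundNE φ (a j i / ceilScale φ (a j))).toRat)
    (hqb : ∀ j i, qb j i = ceilScale φ (b j) * (roundNE φ (b j i / ceilScale φ (b j))).toRat)
    (hacc : |acc - ∑ j, ∑ i, qa j i * qb j i| ≤ γ * ∑ j, ∑ i, |qa j i * qb j i|)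
    (hc : |c - acc| ≤ δ * |acc|) :
    |c - ∑ j, ∑ i, a j i * b j i|
      ≤ let u := φ.unitRoundoff / (1 + φ.unitRoundoff)
        ((u + u + u * u) + γ * (1 + (u + u + u * u)) + δ * (1 + (u + u + u * u)) * (1 + γ))
          * ∑ j, ∑ i, |a j i * b j i| := by
  refine eDec_blocked a b qa qb hγ hδ (fun j i => ?_) (fun j i => ?_) hacc hc
  · rw [hqa]; exact mxCeil_rel_error_le φ (a j) i hM (hca j i) hκM
  · rw [hqb]; exact mxCeil_rel_error_le φ (b j) i hM (hcb j i) hκM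

/-- PER-VECTOR FP GEMM ENVELOPE (functional F1): row of `A` scaled by `X = Aa / maxRat`, column of
`B` by `Ab / maxRat`, with covering numerators (`|aₖ| ≤ Aa`, `|bₖ| ≤ Ab`) and the class
`aₖ = 0 ∨ Aa ≤ κ|aₖ|` (same for `b`), `κ · 2^m · quantum ≤ maxRat`: the same constant as the MX ceil
envelope. [cite: MicikeviciusEtAl2022, §3] -/
theorem gemm_vec_envelope (φ : Format) (hM : 0 < φ.maxRat) {ι : Type*} [Fintype ι]
    (a b qa qb : ι → ℚ) {Aa Ab κ γ δ acc c : ℚ} (hγ : 0 ≤ γ) (hδ : 0 ≤ δ)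
    (hκM : κ * (2 ^ φ.manBits * φ.quantum) ≤ φ.maxRat)
    (hAa : ∀ i, |a i| ≤ Aa) (hAb : ∀ i, |b i| ≤ Ab)
    (hca : ∀ i, a i = 0 ∨ Aa ≤ κ * |a i|) (hcb : ∀ i, b i = 0 ∨ Ab ≤ κ * |b i|)
    (hqa : ∀ i, qa i = Aa / φ.maxRat * (roundNE φ (a i / (Aa / φ.maxRat))).toRat)
    (hqb : ∀ i, qb i = Ab / φ.maxRat * (roundNE φ (b i / (Ab / φ.maxRat))).toRat)
    (hacc : |acc - ∑ i, qa i * qb i| ≤ γ * ∑ i, |qa i * qb i|) (hc : |c - acc| ≤ δ * |acc|) :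
    |c - ∑ i, a i * b i|
      ≤ let u := φ.unitRoundoff / (1 + φ.unitRoundoff)
        ((u + u + u * u) + γ * (1 + (u + u + u * u)) + δ * (1 + (u + u + u * u)) * (1 + γ))
          * ∑ i, |a i * b i| := by
  refine eDec a b qa qb hγ hδ (fun i => ?_) (fun i => ?_) hacc hc
  · rw [hqa]; exact vec_rel_error_le φ hM (hAa i) (hca i) hκM
  · rw [hqb]; exact vec_rel_error_le φ hM (hAb i) (hcb i) hκM

/-- INTEGER (per-vector symmetric, `N` levels; INT8: `N = 127`) GEMM ENVELOPE (functional F1) on the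
class `aₖ = 0 ∨ Aa ≤ κ|aₖ|` (same for `b`) with covering numerators: quantisation constant
`ε = 2g + g²`, `g = κ/(2N)`; the accumulation line is usually `γ = 0` (exact int32 accumulation) and
is kept as a hypothesis. [folklore] -/
theorem gemm_intQ_envelope {ι : Type*} [Fintype ι] (a b qa qb : ι → ℚ)
    {Aa Ab N κ γ δ acc c : ℚ} (hN : 0 < N) (hγ : 0 ≤ γ) (hδ : 0 ≤ δ)
    (hAa : ∀ i, |a i| ≤ Aa) (hAb : ∀ i, |b i| ≤ Ab)
    (hca : ∀ i, a i = 0 ∨ Aa ≤ κ * |a i|) (hcb : ∀ i, b i = 0 ∨ Ab ≤ κ * |b i|)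
    (hqa : ∀ i, qa i = Aa / N * (round (a i / (Aa / N)) : ℚ))
    (hqb : ∀ i, qb i = Ab / N * (round (b i / (Ab / N)) : ℚ))
    (hacc : |acc - ∑ i, qa i * qb i| ≤ γ * ∑ i, |qa i * qb i|) (hc : |c - acc| ≤ δ * |acc|) :
    |c - ∑ i, a i * b i|
      ≤ let g := κ / (2 * N)
        ((g + g + g * g) + γ * (1 + (g + g + g * g)) + δ * (1 + (g + g + g * g)) * (1 + γ))
          * ∑ i, |a i * b i| := by
  refine eDec a b qa qb hγ hδ (fun i => ?_) (fun i => ?_) hacc hc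
  · rw [hqa]; exact intQ_rel_error_le hN (hAa i) (hca i)
  · rw [hqb]; exact intQ_rel_error_le hN (hAb i) (hcb i)

/-! ## The constants of the envelope tables (E4M3 elements) -/

/-- E4M3 numbers of the GEMM envelopes: `u' = 1/17`, quantisation constant `2u' + u'² = 35/289`,
accumulation multiplier `(1 + u')² = 324/289`; normal thresholds `2·2^m·quantum = 1/32` (ceil rule:
`κ ≤ 14336 ⇒ κ/32 ≤ 448`) and `2^m·quantum = 1/64` (per-vector rule: `κ ≤ 28672`); `maxRat = 448`.
[cite: MicikeviciusEtAl2022, Table 1] -/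
theorem e4m3_envelope_constants :
    E4M3.unitRoundoff / (1 + E4M3.unitRoundoff) = 1 / 17 ∧
    (1 / 17 + 1 / 17 + 1 / 17 * (1 / 17) : ℚ) = 35 / 289 ∧
    (1 + (1 / 17 + 1 / 17 + 1 / 17 * (1 / 17)) : ℚ) = 324 / 289 ∧
    2 * (2 ^ E4M3.manBits * E4M3.quantum) = 1 / 32 ∧
    2 ^ E4M3.manBits * E4M3.quantum = 1 / 64 ∧ E4M3.maxRat = 448 ∧
    (14336 : ℚ) * (1 / 32) = 448 ∧ (28672 : ℚ) * (1 / 64) = 448 := by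
  refine ⟨EnvelopeAtoms.sharpUnit_values.1, by norm_num, by norm_num, by decide +kernel, by decide +kernel,
    by decide +kernel, by norm_num, by norm_num⟩

/-- THE E4M3 MX-CEIL GEMM ENVELOPE with numbers: on `C_blk(κ)`, `κ ≤ 14336`, both operands MX-E4M3
with the ceil scale, `|c - ∑∑ a b| ≤ (35/289 + γ · 324/289 + δ · (1+γ) · 324/289) · ∑∑ |a b|`.
[cite: RouhaniEtAl2023MX, §2] -/
theorem gemm_mxCeil_envelope_E4M3 {B k : ℕ} (a b qa qb : Fin B → Fin k → ℚ)
    {κ γ δ acc c : ℚ} (hγ : 0 ≤ γ) (hδ : 0 ≤ δ) (hκ : κ ≤ 14336)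
    (hca : ∀ j i, a j i = 0 ∨ blockMax (a j) ≤ κ * |a j i|)
    (hcb : ∀ j i, b j i = 0 ∨ blockMax (b j) ≤ κ * |b j i|)
    (hqa : ∀ j i, qa j i = ceilScale E4M3 (a j) * (roundNE E4M3 (a j i / ceilScale E4M3 (a j))).toRat)
    (hqb : ∀ j i, qb j i = ceilScale E4M3 (b j) * (roundNE E4M3 (b j i / ceilScale E4M3 (b j))).toRat)
    (hacc : |acc - ∑ j, ∑ i, qa j i * qb j i| ≤ γ * ∑ j, ∑ i, |qa j i * qb j i|)
    (hc : |c - acc| ≤ δ * |acc|) :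
    |c - ∑ j, ∑ i, a j i * b j i|
      ≤ (35 / 289 + γ * (324 / 289) + δ * (324 / 289) * (1 + γ)) * ∑ j, ∑ i, |a j i * b j i| := by
  obtain ⟨hu, -, -, h32, -, hmax, -, -⟩ := e4m3_envelope_constants
  have hM : 0 < E4M3.maxRat := by rw [hmax]; norm_num
  have hκM : κ * (2 * (2 ^ E4M3.manBits * E4M3.quantum)) ≤ E4M3.maxRat := by
    rw [h32, hmax]; linarith
  have h := gemm_mxCeil_envelope E4M3 hM a b qa qb hγ hδ hκM hca hcb hqa hqb hacc hc
  simp only [hu] at h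
  refine le_trans h (le_of_eq ?_)
  ring

/-- THE E4M3 PER-VECTOR GEMM ENVELOPE with numbers: on `C_row(κ)`, `κ ≤ 28672`, covering numerators,
`|c - ∑ a b| ≤ (35/289 + γ · 324/289 + δ · (1+γ) · 324/289) · ∑ |a b|`.
[cite: MicikeviciusEtAl2022, §3] -/
theorem gemm_vec_envelope_E4M3 {ι : Type*} [Fintype ι] (a b qa qb : ι → ℚ)
    {Aa Ab κ γ δ acc c : ℚ} (hγ : 0 ≤ γ) (hδ : 0 ≤ δ) (hκ : κ ≤ 28672)
    (hAa : ∀ i, |a i| ≤ Aa) (hAb : ∀ i, |b i| ≤ Ab)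
    (hca : ∀ i, a i = 0 ∨ Aa ≤ κ * |a i|) (hcb : ∀ i, b i = 0 ∨ Ab ≤ κ * |b i|)
    (hqa : ∀ i, qa i = Aa / E4M3.maxRat * (roundNE E4M3 (a i / (Aa / E4M3.maxRat))).toRat)
    (hqb : ∀ i, qb i = Ab / E4M3.maxRat * (roundNE E4M3 (b i / (Ab / E4M3.maxRat))).toRat)
    (hacc : |acc - ∑ i, qa i * qb i| ≤ γ * ∑ i, |qa i * qb i|) (hc : |c - acc| ≤ δ * |acc|) :
    |c - ∑ i, a i * b i|
      ≤ (35 / 289 + γ * (324 / 289) + δ * (324 / 289) * (1 + γ)) * ∑ i, |a i * b i| := by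
  obtain ⟨hu, -, -, -, h64, hmax, -, -⟩ := e4m3_envelope_constants
  have hM : 0 < E4M3.maxRat := by rw [hmax]; norm_num
  have hκM : κ * (2 ^ E4M3.manBits * E4M3.quantum) ≤ E4M3.maxRat := by
    rw [h64, hmax]; linarith
  have h := gemm_vec_envelope E4M3 hM a b qa qb hγ hδ hκM hAa hAb hca hcb hqa hqb hacc hc
  simp only [hu] at h
  refine le_trans h (le_of_eq ?_)
  ring

/-- THE INT8 GEMM ENVELOPE with numbers (`N = 127`, exact integer accumulation `γ = 0`, no output
rounding `δ = 0`): on `C_row(κ)` with covering numerators, `|∑ qa qb - ∑ a b| ≤ (κ/127 + κ²/64516) · ∑ |a b|`.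
[folklore] -/
theorem gemm_int8_envelope {ι : Type*} [Fintype ι] (a b qa qb : ι → ℚ) {Aa Ab κ : ℚ}
    (hAa : ∀ i, |a i| ≤ Aa) (hAb : ∀ i, |b i| ≤ Ab)
    (hca : ∀ i, a i = 0 ∨ Aa ≤ κ * |a i|) (hcb : ∀ i, b i = 0 ∨ Ab ≤ κ * |b i|)
    (hqa : ∀ i, qa i = Aa / 127 * (round (a i / (Aa / 127)) : ℚ))
    (hqb : ∀ i, qb i = Ab / 127 * (round (b i / (Ab / 127)) : ℚ)) :
    |∑ i, qa i * qb i - ∑ i, a i * b i| ≤ (κ / 127 + κ ^ 2 / 64516) * ∑ i, |a i * b i| := by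
  have h := gemm_intQ_envelope a b qa qb (N := 127) (γ := 0) (δ := 0) (acc := ∑ i, qa i * qb i)
    (c := ∑ i, qa i * qb i) (by norm_num) le_rfl le_rfl hAa hAb hca hcb hqa hqb
    (by simp) (by simp)
  refine le_trans h (le_of_eq ?_)
  ring

end Summit.Ventures.CertifiedArithmetic.LowPrec.GemmEnvelope
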